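import Literature.Computability.MetaComplexity.DPReconstructionKCircuits
import Literature.Computability.MetaComplexity.KtViaRuler
import Literature.Computability.Complexity.SplitOnesBricks
import HarnessLib

/-!
# Complexity meta: the printing program of Hirahara's Thm. 3.12 (`K`-complexity form)

Topic `Literature/Computability/MetaComplexity`. The polynomial-time string function `g` which, fed
through the ruler device of `KtViaRuler.lean` (`UniversalMachine.exists_ktAt_le_of_FP`), realises the
program `M` of Hirahara 2021, proof of Thm. 3.12 (ECCC TR21-058, p. 25):

> "Given an advice string `α := A(x; G_{s'}(σ'))` and seeds `σ` and `σ'`, the program `M` computes and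
> outputs `R^{D_σ}(α; G_{s'}(σ'))` in time `poly(ns/δ)`; we thus obtain `K(x | D) ≤ k + O(log s) + O(log s')`."

On `⟨1^R 0 u, payload⟩` (`R = 2^{|u|}` the ruler) with
`payload = ⟨⟨nums, ⟨[sgn], ⟨σ, σ'⟩⟩⟩, ⟨b, α⟩⟩`, `nums` the binary numerals of
`t, n, k, m, M, j, N₁, N₂, C` (all `≤ R`), the function `DPKProg.gF D₀ F` expands the numerals to unary
under the ruler (`binToUnaryFn`), forms the auxiliary input `a = ⟨1ᵗ, b⟩`, the test's coins
`ρ = F⟨1^{N₁}, σ⟩↾m` and the reconstruction's coins `w = F⟨1^{N₂}, σ'⟩↾C` (`padTakeFn`), and runs the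
reconstruction `DPHybProg.hrecF D₀ ⟨hparams a n k M j sgn α ρ, w⟩` of `DPReconstructionHybridProgram.lean`.

* `DPKProg.numsOf`, `DPKProg.payloadOf` — the payload; `length_payloadOf_le` (its length:
  `2|b| + |α| + O(numerals + seeds)`);
* `DPKProg.gF`, `gF_apply` (value on a genuine payload under a long enough ruler), `gF_mem_FP`.

## References

* S. Hirahara, ECCC TR21-058 (2021), proof of Thm. 3.12 (p. 25).
* S. Arora, B. Barak, *Computational Complexity: A Modern Approach*, CUP 2009, §1.3–1.4.
-/

noncomputable section

namespace Literature.Computability.MetaComplexity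

open _root_.Computability Polynomial Complexity Complexity.Brick Complexity.Plumb Complexity.OracleCompose Complexity.HashBricks
open Literature.Computability.Cryptography Cryptography.CondRed

namespace DPKProg

/-! ### The payload -/

/-- The nine binary numerals `⟨t, n, k, m, M, j, N₁, N₂, C⟩`. [folklore] -/
def numsOf (t n k m M j N₁ N₂ C : ℕ) : List Bool :=
  boolPair (encodeNat t) (boolPair (encodeNat n) (boolPair (encodeNat k) (boolPair (encodeNat m) (boolPair (encodeNat M)
    (boolPair (encodeNat j) (boolPair (encodeNat N₁) (boolPair (encodeNat N₂) (encodeNat C))))))))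

/-- **The payload** `⟨⟨nums, ⟨[sgn], ⟨σ, σ'⟩⟩⟩, ⟨b, α⟩⟩` (the advice `α` raw at the end, the short
auxiliary input `b` one level up, everything else `O(log)`-size). [cite: Hirahara2021, Thm. 3.12 (proof)] -/
def payloadOf (t n k m M j N₁ N₂ C : ℕ) (sgn : Bool) (σ σ' b α : List Bool) : List Bool :=
  boolPair (boolPair (numsOf t n k m M j N₁ N₂ C) (boolPair [sgn] (boolPair σ σ'))) (boolPair b α)

/-- Binary numerals of bounded numbers are uniformly short (`TM2Pass.length_encodeNat_le`). [folklore] -/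
theorem length_encodeNat_le_of_le {v B : ℕ} (h : v ≤ B) : (encodeNat v).length ≤ Nat.log 2 B + 1 :=
  (TM2Pass.length_encodeNat_le v).trans (Nat.succ_le_succ (Nat.log_mono_right h))

/-- **Length of the numerals**: `≤ 17(log₂ B + 1) + 16` when all nine numbers are `≤ B`. [folklore] -/
theorem length_numsOf_le {t n k m M j N₁ N₂ C B : ℕ} (ht : t ≤ B) (hn : n ≤ B) (hk : k ≤ B) (hm : m ≤ B) (hM : M ≤ B) (hj : j ≤ B)
    (h1 : N₁ ≤ B) (h2 : N₂ ≤ B) (hC : C ≤ B) :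
    (numsOf t n k m M j N₁ N₂ C).length ≤ 17 * (Nat.log 2 B + 1) + 16 := by
  have := length_encodeNat_le_of_le ht; have := length_encodeNat_le_of_le hn; have := length_encodeNat_le_of_le hk
  have := length_encodeNat_le_of_le hm; have := length_encodeNat_le_of_le hM; have := length_encodeNat_le_of_le hj
  have := length_encodeNat_le_of_le h1; have := length_encodeNat_le_of_le h2; have := length_encodeNat_le_of_le hC
  simp only [numsOf, length_boolPair]
  omega

/-- **Length of the payload**: `|payload| = 4|nums| + 4|σ| + 2|σ'| + 2|b| + |α| + 20`. [folklore] -/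
theorem length_payloadOf (t n k m M j N₁ N₂ C : ℕ) (sgn : Bool) (σ σ' b α : List Bool) :
    (payloadOf t n k m M j N₁ N₂ C sgn σ σ' b α).length =
      4 * (numsOf t n k m M j N₁ N₂ C).length + 4 * σ.length + 2 * σ'.length + 2 * b.length + α.length + 20 := by
  simp only [payloadOf, length_boolPair, List.length_singleton]
  ring

/-! ### The program (on `z = ⟨1^R 0 u, payload⟩`) -/

section Program

variable (D₀ : Set (List Bool)) (F : List Bool → List Bool)

/-- The ruler `1^R`. [folklore] -/
def rulerF : List Bool → List Bool := onesPrefixFn ∘ fstF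
/-- `cnum = ⟨nums, ⟨[sgn], ⟨σ, σ'⟩⟩⟩`. [folklore] -/
def cnumF : List Bool → List Bool := fstF ∘ sndF
/-- `nums`. [folklore] -/
def numsF : List Bool → List Bool := fstF ∘ cnumF
/-- The unary expansion `1^{vᵢ}` of numeral `i ≤ 7` under the ruler. [folklore] -/
def numU (i : ℕ) : List Bool → List Bool := binToUnaryFn ∘ fanoutFn rulerF (nthF i ∘ numsF)
/-- The unary expansion `1^C` of the last numeral. [folklore] -/
def num8U : List Bool → List Bool := binToUnaryFn ∘ fanoutFn rulerF (sndPow 7 ∘ numsF)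
/-- `[sgn]`. [folklore] -/
def sgnB : List Bool → List Bool := headBitFn ∘ nthF 1 ∘ cnumF
/-- `σ`. [folklore] -/
def σF : List Bool → List Bool := nthF 2 ∘ cnumF
/-- `σ'`. [folklore] -/
def σ'F : List Bool → List Bool := sndPow 2 ∘ cnumF
/-- `b`. [folklore] -/
def bF : List Bool → List Bool := fstF ∘ sndF ∘ sndF
/-- `α`. [folklore] -/
def αF : List Bool → List Bool := sndF ∘ sndF ∘ sndF
/-- The auxiliary input `a = ⟨1ᵗ, b⟩`. [folklore] -/
def aF : List Bool → List Bool := fanoutFn (numU 0) bF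
/-- The test's coins `ρ = F⟨1^{N₁}, σ⟩↾m`. [cite: Hirahara2021, Thm. 3.12 (proof)] -/
def ρF : List Bool → List Bool := fstF ∘ padTakeFn ∘ fanoutFn (numU 3) (F ∘ fanoutFn (numU 6) σF)
/-- The reconstruction's coins `w = F⟨1^{N₂}, σ'⟩↾C`. [cite: Hirahara2021, Thm. 3.12 (proof)] -/
def wF : List Bool → List Bool := fstF ∘ padTakeFn ∘ fanoutFn num8U (F ∘ fanoutFn (numU 7) σ'F)
/-- The parameter record `⟨a, 1ⁿ, 1ᵏ, 1^M, 1ʲ, [sgn], α, ρ⟩`. [folklore] -/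
def paramsF : List Bool → List Bool :=
  fanoutFn aF (fanoutFn (numU 1) (fanoutFn (numU 2) (fanoutFn (numU 4) (fanoutFn (numU 5) (fanoutFn sgnB (fanoutFn αF (ρF F)))))))
/-- **The printing program** `M`: the reconstruction on the decoded parameters and the pseudorandom
coins. [cite: Hirahara2021, Thm. 3.12 (proof)] -/
def gF : List Bool → List Bool := DPHybProg.hrecF D₀ ∘ fanoutFn (paramsF F) (wF F)

end Program

/-! ### Values on a genuine payload under a long enough ruler -/

section Values

variable (F : List Bool → List Bool) (u : List Bool) (t n k m M j N₁ N₂ C : ℕ) (sgn : Bool) (σ σ' b α : List Bool)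

/-- The argument `⟨expPad 1 u, payload⟩`. [folklore] -/
def zOf : List Bool := boolPair (expPad 1 u) (payloadOf t n k m M j N₁ N₂ C sgn σ σ' b α)

/-- Value of `rulerF`: `1^{2^{|u|}}`. [folklore] -/
theorem rulerF_apply : rulerF (zOf u t n k m M j N₁ N₂ C sgn σ σ' b α) = ones (2 ^ u.length) := by
  simp only [rulerF, zOf, Function.comp_apply, fstF_boolPair, expPad, pow_one]
  exact onesPrefixFn_ones_append _ _
/-- Value of `cnumF`. [folklore] -/
theorem cnumF_apply : cnumF (zOf u t n k m M j N₁ N₂ C sgn σ σ' b α) = boolPair (numsOf t n k m M j N₁ N₂ C) (boolPair [sgn] (boolPair σ σ')) := by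
  simp only [cnumF, zOf, payloadOf, Function.comp_apply, sndF_boolPair, fstF_boolPair]
/-- Value of `numsF`. [folklore] -/
theorem numsF_apply : numsF (zOf u t n k m M j N₁ N₂ C sgn σ σ' b α) = numsOf t n k m M j N₁ N₂ C := by
  simp only [numsF, Function.comp_apply, cnumF_apply, fstF_boolPair]

/-- The unary expansion of a numeral `≤ R` under the ruler `1^R`. [folklore] -/
theorem binToUnary_ruler {v R : ℕ} (hv : v ≤ R) : binToUnaryFn (boolPair (ones R) (encodeNat v)) = ones v := by
  rw [binToUnaryFn_boolPair, bitsToNat_encodeNat, List.length_replicate, min_eq_left hv]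

variable {u t n k m M j N₁ N₂ C}

/-- Values of the nine unary expansions. [folklore] -/
theorem numU_apply (ht : t ≤ 2 ^ u.length) (hn : n ≤ 2 ^ u.length) (hk : k ≤ 2 ^ u.length) (hm : m ≤ 2 ^ u.length)
    (hM : M ≤ 2 ^ u.length) (hj : j ≤ 2 ^ u.length) (h1 : N₁ ≤ 2 ^ u.length) (h2 : N₂ ≤ 2 ^ u.length) (hC : C ≤ 2 ^ u.length) :
    numU 0 (zOf u t n k m M j N₁ N₂ C sgn σ σ' b α) = ones t ∧ numU 1 (zOf u t n k m M j N₁ N₂ C sgn σ σ' b α) = ones n ∧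
    numU 2 (zOf u t n k m M j N₁ N₂ C sgn σ σ' b α) = ones k ∧ numU 3 (zOf u t n k m M j N₁ N₂ C sgn σ σ' b α) = ones m ∧
    numU 4 (zOf u t n k m M j N₁ N₂ C sgn σ σ' b α) = ones M ∧ numU 5 (zOf u t n k m M j N₁ N₂ C sgn σ σ' b α) = ones j ∧
    numU 6 (zOf u t n k m M j N₁ N₂ C sgn σ σ' b α) = ones N₁ ∧ numU 7 (zOf u t n k m M j N₁ N₂ C sgn σ σ' b α) = ones N₂ ∧
    num8U (zOf u t n k m M j N₁ N₂ C sgn σ σ' b α) = ones C := by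
  simp only [numU, num8U, Function.comp_apply, fanoutFn_apply, rulerF_apply, numsF_apply, numsOf, nthF_zero_boolPair, nthF_succ_boolPair,
    sndPow_succ_boolPair, sndPow_zero_boolPair, binToUnary_ruler ht, binToUnary_ruler hn, binToUnary_ruler hk, binToUnary_ruler hm,
    binToUnary_ruler hM, binToUnary_ruler hj, binToUnary_ruler h1, binToUnary_ruler h2, binToUnary_ruler hC, and_self]

variable (u t n k m M j N₁ N₂ C)

/-- Value of `sgnB`. [folklore] -/
theorem sgnB_apply : sgnB (zOf u t n k m M j N₁ N₂ C sgn σ σ' b α) = [sgn] := by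
  simp only [sgnB, Function.comp_apply, cnumF_apply, nthF_succ_boolPair, nthF_zero_boolPair, headBitFn_apply, List.headD_cons]
/-- Value of `σF`. [folklore] -/
theorem σF_apply : σF (zOf u t n k m M j N₁ N₂ C sgn σ σ' b α) = σ := by
  simp only [σF, Function.comp_apply, cnumF_apply, nthF_succ_boolPair, nthF_zero_boolPair]
/-- Value of `σ'F`. [folklore] -/
theorem σ'F_apply : σ'F (zOf u t n k m M j N₁ N₂ C sgn σ σ' b α) = σ' := by
  simp only [σ'F, Function.comp_apply, cnumF_apply, sndPow_succ_boolPair, sndPow_zero_boolPair]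
/-- Value of `bF`. [folklore] -/
theorem bF_apply : bF (zOf u t n k m M j N₁ N₂ C sgn σ σ' b α) = b := by
  simp only [bF, zOf, payloadOf, Function.comp_apply, sndF_boolPair, fstF_boolPair]
/-- Value of `αF`. [folklore] -/
theorem αF_apply : αF (zOf u t n k m M j N₁ N₂ C sgn σ σ' b α) = α := by
  simp only [αF, zOf, payloadOf, Function.comp_apply, sndF_boolPair]

variable {u t n k m M j N₁ N₂ C}

/-- **The program on a genuine payload under a long enough ruler** runs the reconstruction on the
decoded parameters, the test coins `F⟨1^{N₁}, σ⟩↾m` and the reconstruction coins `F⟨1^{N₂}, σ'⟩↾C`.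
[cite: Hirahara2021, Thm. 3.12 (proof)] -/
theorem gF_apply (D₀ : Set (List Bool)) (ht : t ≤ 2 ^ u.length) (hn : n ≤ 2 ^ u.length) (hk : k ≤ 2 ^ u.length) (hm : m ≤ 2 ^ u.length)
    (hM : M ≤ 2 ^ u.length) (hj : j ≤ 2 ^ u.length) (h1 : N₁ ≤ 2 ^ u.length) (h2 : N₂ ≤ 2 ^ u.length) (hC : C ≤ 2 ^ u.length) :
    gF D₀ F (zOf u t n k m M j N₁ N₂ C sgn σ σ' b α) =
      DPHybProg.hrecF D₀ (boolPair (DPHybProg.hparams (boolPair (ones t) b) n k M j sgn α (List.takeD m (F (boolPair (ones N₁) σ)) false))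
        (List.takeD C (F (boolPair (ones N₂) σ')) false)) := by
  obtain ⟨e0, e1, e2, e3, e4, e5, e6, e7, e8⟩ := numU_apply sgn σ σ' b α ht hn hk hm hM hj h1 h2 hC
  simp only [gF, Function.comp_apply, fanoutFn_apply, paramsF, aF, ρF, wF, e0, e1, e2, e3, e4, e5, e6, e7, e8, bF_apply, αF_apply, sgnB_apply,
    σF_apply, σ'F_apply, padTakeFn_boolPair, fstF_boolPair, List.length_replicate, DPHybProg.hparams]

end Values

/-! ### Polynomial time -/

/-- **`gF D₀ F ∈ FP`** for `D₀ ∈ P` and `F ∈ FP`. [cite: Hirahara2021, Thm. 3.12 (proof)] -/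
theorem gF_mem_FP {D₀ : Set (List Bool)} {F : List Bool → List Bool} (hD₀ : D₀ ∈ Classes.P) (hF : F ∈ FP) : gF D₀ F ∈ FP := by
  have hruler : rulerF ∈ FP := comp_mem_FP onesPrefixFn_mem_FP fstF_mem_FP
  have hcnum : cnumF ∈ FP := comp_mem_FP fstF_mem_FP sndF_mem_FP
  have hnums : numsF ∈ FP := comp_mem_FP fstF_mem_FP hcnum
  have hnum : ∀ i, numU i ∈ FP := fun i => comp_mem_FP binToUnaryFn_mem_FP (fanoutFn_mem_FP hruler (comp_mem_FP (nthF_mem_FP i) hnums))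
  have hnum8 : num8U ∈ FP := comp_mem_FP binToUnaryFn_mem_FP (fanoutFn_mem_FP hruler (comp_mem_FP (sndPow_mem_FP 7) hnums))
  have hsgn : sgnB ∈ FP := comp_mem_FP headBitFn_mem_FP (comp_mem_FP (nthF_mem_FP 1) hcnum)
  have hσ : σF ∈ FP := comp_mem_FP (nthF_mem_FP 2) hcnum
  have hσ' : σ'F ∈ FP := comp_mem_FP (sndPow_mem_FP 2) hcnum
  have hb : bF ∈ FP := comp_mem_FP fstF_mem_FP (comp_mem_FP sndF_mem_FP sndF_mem_FP)
  have hα : αF ∈ FP := comp_mem_FP sndF_mem_FP (comp_mem_FP sndF_mem_FP sndF_mem_FP)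
  have ha : aF ∈ FP := fanoutFn_mem_FP (hnum 0) hb
  have hρ : ρF F ∈ FP := comp_mem_FP fstF_mem_FP (comp_mem_FP padTakeFn_mem_FP (fanoutFn_mem_FP (hnum 3) (comp_mem_FP hF (fanoutFn_mem_FP (hnum 6) hσ))))
  have hw : wF F ∈ FP := comp_mem_FP fstF_mem_FP (comp_mem_FP padTakeFn_mem_FP (fanoutFn_mem_FP hnum8 (comp_mem_FP hF (fanoutFn_mem_FP (hnum 7) hσ'))))
  have hparams : paramsF F ∈ FP :=
    fanoutFn_mem_FP ha (fanoutFn_mem_FP (hnum 1) (fanoutFn_mem_FP (hnum 2) (fanoutFn_mem_FP (hnum 4) (fanoutFn_mem_FP (hnum 5)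
      (fanoutFn_mem_FP hsgn (fanoutFn_mem_FP hα hρ))))))
  exact comp_mem_FP (DPHybProg.hrecF_mem_FP D₀ hD₀) (fanoutFn_mem_FP hparams hw)

end DPKProg

end Literature.Computability.MetaComplexity

end
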